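import Literature.NumberTheory.EllipticCurves.CuspFormRankinSelbergTrace
import Literature.NumberTheory.EllipticCurves.CuspFunctionParseval
import Mathlib.Analysis.Fourier.AddCircle
import Mathlib.Analysis.SpecialFunctions.Integrals.Basic
import HarnessLib

/-!
# The coefficient sequence of the Rankin–Selberg trace and its horocycle integral

Topic `NumberTheory/EllipticCurves` (modular forms for `Γ₀(N)`); namespace
`Literature.NumberTheory.EllipticCurves.ModularForms`. Sequel to `CuspFormRankinSelbergTrace`
(the `SL₂(ℤ)`-invariant trace `G_f = rsTrace N k f = Σ_{SL₂(ℤ)/Γ₀(N)} |f|_k A⁻¹|² yᵏ`) and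
`CuspFunctionParseval` (Parseval on horizontal lines for cuspidal `q`-series). We DEFINE the
non-negative **coefficient sequence of the trace**

`rsCoeff N k f n = Σ_{SL₂(ℤ)/Γ₀(N)} |(qExpansion_N (f |_k A⁻¹))_n|²`

(period-`N` Fourier coefficients of the translates) and PROVE (Rankin 1939, §4.2, (4.2.3);
Iwaniec–Kowalski §5.1):

* `qExpansion_coeff_level_mul` — `(qExpansion_N f)_{N m} = a_m(f)` (period `N` versus period `1`),
  hence `norm_sq_cuspCoeff_le_rsCoeff` — **`|a_m(f)|² ≤ rsCoeff N k f (N m)`** (the identity coset);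
* `intervalIntegral_rsTrace_horizontal` — **the horocycle identity**
  `∫₀¹ G_f(x + iy) dx = yᵏ Σₙ rsCoeff(n) e^{-4π n y/N}` (Parseval for each translate over a period
  `N`, and `1`-periodicity of `G_f` to pass from `∫₀ᴺ` to `∫₀¹`);
* `tsum_rsCoeff_mul_exp_le` — `Σₙ rsCoeff(n) e^{-4πny/N} ≤ B y^{-k}` from `G_f ≤ B`.

These are the modular-form inputs of the Rankin–Selberg power saving for the coefficients
(`Literature.NumberTheory.Automorphic.RankinSelberg*`, `Literature.Analysis.Complex.PerronPowerSaving`).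

## References

* R. A. Rankin, *Contributions to the theory of Ramanujan's function τ(n) and similar arithmetical
  functions II*, Proc. Cambridge Philos. Soc. 35 (1939), 357–372, §4.2.
* H. Iwaniec, E. Kowalski, *Analytic Number Theory*, AMS Colloquium Publ. 53 (2004), §5.1.
-/

noncomputable section

open ModularForm CongruenceSubgroup Complex Filter
open UpperHalfPlane hiding I
open scoped MatrixGroups ModularForm Topology

namespace Literature.NumberTheory.EllipticCurves.ModularForms

open MeasureTheory Set intervalIntegral

/-! ### Period-`N` coefficients of a form on `Γ₀(N)` and the coefficient sequence of the trace -/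

section Coefficients

variable {N : ℕ} [NeZero N] {k : ℤ}

omit [NeZero N] in
/-- `f |_k γ = f` for `γ ∈ Γ₀(N)` (any weight; `SL₂(ℤ)`-slash). [folklore] -/
theorem slash_eq_self_of_mem_Gamma0 {F : Type*} [FunLike F ℍ ℂ]
    [SlashInvariantFormClass F (Gamma0 N) k] (f : F) {γ : SL(2, ℤ)} (hγ : γ ∈ Gamma0 N) :
    (⇑f) ∣[k] γ = ⇑f := by
  rw [ModularForm.SL_slash]
  exact SlashInvariantForm.slash_action_eqn f _
    (Subgroup.mem_map_of_mem (Matrix.SpecialLinearGroup.mapGL ℝ) hγ)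

/-- A cusp form on `Γ₀(N)` is a cuspidal `q`-series of period `N` as well. [folklore] -/
theorem isCuspFunction_level (f : CuspForm (Gamma0 N) k) : IsCuspFunction N ⇑f := by
  simpa using isCuspFunction_slash f 1

omit [NeZero N] in
/-- `∫₀ⁿ g = n ∫₀¹ g` for a continuous `1`-periodic `g`. [folklore] -/
theorem intervalIntegral_zero_nat_of_periodic {E : Type*} [NormedAddCommGroup E] [NormedSpace ℝ E]
    {g : ℝ → E} (hg : Function.Periodic g 1) (hc : Continuous g) (n : ℕ) :
    ∫ x in (0 : ℝ)..n, g x = (n : ℝ) • ∫ x in (0 : ℝ)..1, g x := by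
  have h := hg.intervalIntegral_add_zsmul_eq (n : ℤ) 0 (fun t₁ t₂ ↦ hc.intervalIntegrable t₁ t₂)
  simp only [zero_add, zsmul_eq_mul, Int.cast_natCast, mul_one, natCast_zsmul] at h
  rw [h, Nat.cast_smul_eq_nsmul]

/-- **Period-`N` versus period-`1` coefficients**: for `f ∈ S_k(Γ₀(N))`,
`(qExpansion N f)_{N m} = a_m(f)` — both are `e^{2πm}` times the `m`-th Fourier coefficient of
`x ↦ f(x + i)` over one period (`fourierCoeffOn_horizontal` at periods `N` and `1`; the period-`N`
coefficient of index `N m` of a `1`-periodic function is its period-`1` coefficient of index `m`).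
[folklore] -/
theorem qExpansion_coeff_level_mul (f : CuspForm (Gamma0 N) k) (m : ℕ) :
    (qExpansion (N : ℝ) ⇑f).coeff (N * m) = cuspCoeff f m := by
  have hNf := isCuspFunction_level f
  have h1f := isCuspFunction_one f
  have eN := hNf.fourierCoeffOn_horizontal one_pos ((N * m : ℕ) : ℤ)
  have e1 := h1f.fourierCoeffOn_horizontal one_pos (m : ℤ)
  rw [if_pos (Int.natCast_nonneg _), Int.toNat_natCast] at eN e1
  -- the two Fourier coefficients agree
  set g : ℝ → ℂ := fun x : ℝ ↦ (⇑f) (ofComplex ((x : ℂ) + (1 : ℝ) * I)) with hg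
  have hgp : Function.Periodic g 1 := by
    intro x
    simp only [hg]
    have := h1f.periodic ((x : ℂ) + (1 : ℝ) * I)
    simp only [Function.comp_apply] at this
    push_cast at this ⊢
    rw [show (x : ℂ) + 1 + 1 * I = (x : ℂ) + 1 * I + 1 by ring]
    exact this
  have hgc : Continuous g := h1f.continuous_horizontal one_pos
  have hF : fourierCoeffOn hNf.pos g ((N * m : ℕ) : ℤ) = fourierCoeffOn h1f.pos g (m : ℤ) := by
    rw [fourierCoeffOn_eq_integral, fourierCoeffOn_eq_integral]
    have hi : ∀ x : ℝ, fourier (-((N * m : ℕ) : ℤ)) (x : AddCircle ((N : ℝ) - 0)) • g x =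
        fourier (-(m : ℤ)) (x : AddCircle ((1 : ℝ) - 0)) • g x := by
      intro x
      simp only [fourier_coe_apply, sub_zero]
      congr 1
      congr 1
      have hNc : (N : ℂ) ≠ 0 := by exact_mod_cast (NeZero.ne N)
      push_cast
      field_simp
    simp_rw [hi]
    have hper : Function.Periodic
        (fun x : ℝ ↦ fourier (-(m : ℤ)) (x : AddCircle ((1 : ℝ) - 0)) • g x) 1 := by
      intro x
      simp only [fourier_coe_apply, sub_zero]
      rw [hgp x]
      congr 1
      push_cast
      rw [div_one, div_one, mul_add, Complex.exp_add, mul_one,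
        show (2 * (Real.pi : ℂ) * I * -(m : ℂ) : ℂ) = ((-(m : ℤ) : ℤ) : ℂ) * (2 * Real.pi * I) by
          push_cast; ring,
        Complex.exp_int_mul_two_pi_mul_I, mul_one]
    have hcont : Continuous fun x : ℝ ↦ fourier (-(m : ℤ)) (x : AddCircle ((1 : ℝ) - 0)) • g x :=
      ((fourier (-(m : ℤ))).continuous.comp (AddCircle.continuous_mk' _)).smul hgc
    rw [intervalIntegral_zero_nat_of_periodic hper hcont N, ← smul_assoc, smul_eq_mul, sub_zero,
      sub_zero, one_div, inv_mul_cancel₀ (Nat.cast_ne_zero.mpr (NeZero.ne N)), div_one, one_smul]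
  rw [hF, e1] at eN
  -- cancel the common exponential factor
  have hexp : (Real.exp (-(2 * Real.pi * m / 1) * 1) : ℂ) ≠ 0 := by
    exact_mod_cast (Real.exp_pos _).ne'
  have hexp' : (Real.exp (-(2 * Real.pi * (N * m : ℕ) / N) * 1) : ℂ) =
      (Real.exp (-(2 * Real.pi * m / 1) * 1) : ℂ) := by
    congr 2
    have hNr : (N : ℝ) ≠ 0 := Nat.cast_ne_zero.mpr (NeZero.ne N)
    push_cast
    field_simp
  rw [hexp'] at eN
  have := mul_right_cancel₀ hexp eN
  rw [cuspCoeff, ← this]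

variable (N k) in
/-- The **coefficient sequence of the trace**: `C_f(n) = Σ_{A ∈ SL₂(ℤ)/Γ₀(N)} |c_n(f |_k A⁻¹)|²`,
the sum of the squares of the `n`-th period-`N` `q`-expansion coefficients of the translates
`f |_k A⁻¹` over the coset representatives `A = Quotient.out q` (Rankin 1939, §4, the
coefficients `Σ_j |a_n^{(j)}|²` of (4.2.3)). [cite: Rankin1939, §4] -/
def rsCoeff (f : ℍ → ℂ) (n : ℕ) : ℝ :=
  ∑ᶠ q : SL(2, ℤ) ⧸ Gamma0 N, ‖(qExpansion (N : ℝ) (f ∣[k] (Quotient.out q)⁻¹)).coeff n‖ ^ 2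

omit [NeZero N] in
/-- `C_f(n)` as a finite sum. [folklore] -/
theorem rsCoeff_eq_sum [Fintype (SL(2, ℤ) ⧸ Gamma0 N)] (f : ℍ → ℂ) (n : ℕ) :
    rsCoeff N k f n = ∑ q : SL(2, ℤ) ⧸ Gamma0 N,
      ‖(qExpansion (N : ℝ) (f ∣[k] (Quotient.out q)⁻¹)).coeff n‖ ^ 2 := by
  unfold rsCoeff
  exact finsum_eq_sum_of_fintype _

omit [NeZero N] in
/-- `C_f(n) ≥ 0`. [folklore] -/
theorem rsCoeff_nonneg (f : ℍ → ℂ) (n : ℕ) : 0 ≤ rsCoeff N k f n :=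
  finsum_nonneg fun _ ↦ sq_nonneg _

/-- `C_f(0) = 0` for a cusp form (every translate is cuspidal at `∞`). [folklore] -/
theorem rsCoeff_zero (f : CuspForm (Gamma0 N) k) : rsCoeff N k f 0 = 0 := by
  classical
  haveI : Fintype (SL(2, ℤ) ⧸ Gamma0 N) := Fintype.ofFinite _
  rw [rsCoeff_eq_sum]
  refine Finset.sum_eq_zero fun q _ ↦ ?_
  rw [(isCuspFunction_slash f _).coeff_zero, norm_zero, zero_pow two_ne_zero]

/-- **`|a_m(f)|² ≤ C_f(N m)`**: the identity coset contributes `|c_{Nm}(f)|² = |a_m(f)|²`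
(`qExpansion_coeff_level_mul`). [cite: Rankin1939, §4] -/
theorem norm_sq_cuspCoeff_le_rsCoeff (f : CuspForm (Gamma0 N) k) (m : ℕ) :
    ‖cuspCoeff f m‖ ^ 2 ≤ rsCoeff N k f (N * m) := by
  classical
  haveI : Fintype (SL(2, ℤ) ⧸ Gamma0 N) := Fintype.ofFinite _
  rw [rsCoeff_eq_sum]
  set q₀ : SL(2, ℤ) ⧸ Gamma0 N := QuotientGroup.mk 1 with hq₀def
  obtain ⟨h, hh⟩ := QuotientGroup.mk_out_eq_mul (Gamma0 N) (1 : SL(2, ℤ))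
  have hq₀ : (⇑f) ∣[k] (Quotient.out q₀)⁻¹ = ⇑f := by
    rw [hq₀def, hh, one_mul]
    exact slash_eq_self_of_mem_Gamma0 f (inv_mem h.2)
  have h1 : ‖cuspCoeff f m‖ ^ 2 =
      ‖(qExpansion (N : ℝ) ((⇑f) ∣[k] (Quotient.out q₀)⁻¹)).coeff (N * m)‖ ^ 2 := by
    rw [hq₀, qExpansion_coeff_level_mul]
  rw [h1]
  exact Finset.single_le_sum (f := fun q : SL(2, ℤ) ⧸ Gamma0 N ↦
    ‖(qExpansion (N : ℝ) ((⇑f) ∣[k] (Quotient.out q)⁻¹)).coeff (N * m)‖ ^ 2)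
    (fun q _ ↦ sq_nonneg _) (Finset.mem_univ _)

end Coefficients

/-! ### The horocycle average of the trace -/

section Horocycle

variable {N : ℕ} [NeZero N] {k : ℤ}

/-- `G_f(x + 1 + iy) = G_f(x + iy)`: the trace is `1`-periodic along horocycles (`T ∈ SL₂(ℤ)`).
[folklore] -/
theorem periodic_rsTrace_horizontal (f : CuspForm (Gamma0 N) k) {y : ℝ} (hy : 0 < y) :
    Function.Periodic (fun x : ℝ ↦ rsTrace N k f (ofComplex ((x : ℂ) + y * I))) 1 := by
  intro x
  have him : 0 < ((x : ℂ) + y * I).im := by simpa using hy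
  have him' : 0 < ((((x + 1 : ℝ) : ℂ)) + y * I).im := by simpa using hy
  dsimp only
  have hT : ofComplex ((((x + 1 : ℝ) : ℂ)) + y * I) =
      ModularGroup.T • ofComplex ((x : ℂ) + y * I) := by
    rw [ofComplex_apply_of_im_pos him, ofComplex_apply_of_im_pos him']
    apply UpperHalfPlane.ext
    rw [UpperHalfPlane.modular_T_smul, coe_vadd]
    push_cast
    ring
  rw [hT, rsTrace_smul]

/-- The horocycle section `x ↦ G_f(x + iy)` is continuous. [folklore] -/
theorem continuous_rsTrace_horizontal (f : CuspForm (Gamma0 N) k) {y : ℝ} (hy : 0 < y) :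
    Continuous fun x : ℝ ↦ rsTrace N k f (ofComplex ((x : ℂ) + y * I)) := by
  have him : ∀ x : ℝ, 0 < ((x : ℂ) + y * I).im := fun x ↦ by simpa using hy
  have e : (fun x : ℝ ↦ rsTrace N k f (ofComplex ((x : ℂ) + y * I))) =
      fun x : ℝ ↦ rsTrace N k f ⟨(x : ℂ) + y * I, him x⟩ := by
    funext x; rw [ofComplex_apply_of_im_pos (him x)]
  rw [e]
  exact (continuous_rsTrace (ModularFormClass.continuous f)).comp
    (Continuous.upperHalfPlaneMk (by fun_prop) him)

/-- Each translate contributes `∫₀ᴺ F_f(A(x + iy)) dx = yᵏ · N Σₙ |cₙ(f|A)|² e^{-4πny/N}`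
(`petDensity_slash` and Parseval for the cusp function `f |_k A` of period `N`).
[cite: Rankin1939, §4] -/
theorem intervalIntegral_petDensity_smul_horizontal (f : CuspForm (Gamma0 N) k) (A : SL(2, ℤ))
    {y : ℝ} (hy : 0 < y) :
    ∫ x in (0 : ℝ)..N, petDensity k f (A • ofComplex ((x : ℂ) + y * I)) =
      y ^ k * ((N : ℝ) * ∑' n : ℕ, ‖(qExpansion (N : ℝ) ((⇑f) ∣[k] A)).coeff n‖ ^ 2 *
        Real.exp (-(4 * Real.pi * n / N) * y)) := by
  have him : ∀ x : ℝ, 0 < ((x : ℂ) + y * I).im := fun x ↦ by simpa using hy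
  have hA := isCuspFunction_slash f A
  have e : ∀ x : ℝ, petDensity k f (A • ofComplex ((x : ℂ) + y * I)) =
      y ^ k * ‖((⇑f) ∣[k] A) (ofComplex ((x : ℂ) + y * I))‖ ^ 2 := by
    intro x
    rw [← petDensity_slash, petDensity, ofComplex_apply_of_im_pos (him x), mul_comm]
    congr 2
    show ((x : ℂ) + y * I).im = y
    simp
  simp_rw [e]
  rw [intervalIntegral.integral_const_mul, hA.integral_norm_sq_horizontal hy]

omit [NeZero N] in
/-- Continuity of `x ↦ F_f(A(x + iy))`. [folklore] -/
theorem continuous_petDensity_smul_horizontal (f : CuspForm (Gamma0 N) k) (A : SL(2, ℤ))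
    {y : ℝ} (hy : 0 < y) :
    Continuous fun x : ℝ ↦ petDensity k f (A • ofComplex ((x : ℂ) + y * I)) := by
  have him : ∀ x : ℝ, 0 < ((x : ℂ) + y * I).im := fun x ↦ by simpa using hy
  have e : (fun x : ℝ ↦ petDensity k f (A • ofComplex ((x : ℂ) + y * I))) =
      fun x : ℝ ↦ petDensity k f (A • ⟨(x : ℂ) + y * I, him x⟩) := by
    funext x; rw [ofComplex_apply_of_im_pos (him x)]
  rw [e]
  exact (continuous_petDensity_smul (k := k) (ModularFormClass.continuous f) A).comp
    (Continuous.upperHalfPlaneMk (by fun_prop) him)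

/-- Summability of `Σₙ C_f(n) e^{-4πny/N}` (`y > 0`). [folklore] -/
theorem summable_rsCoeff_mul_exp (f : CuspForm (Gamma0 N) k) {y : ℝ} (hy : 0 < y) :
    Summable fun n : ℕ ↦ rsCoeff N k f n * Real.exp (-(4 * Real.pi * n / N) * y) := by
  classical
  haveI : Fintype (SL(2, ℤ) ⧸ Gamma0 N) := Fintype.ofFinite _
  have e : (fun n : ℕ ↦ rsCoeff N k f n * Real.exp (-(4 * Real.pi * n / N) * y)) =
      fun n ↦ ∑ q : SL(2, ℤ) ⧸ Gamma0 N,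
        ‖(qExpansion (N : ℝ) ((⇑f) ∣[k] (Quotient.out q)⁻¹)).coeff n‖ ^ 2 *
          Real.exp (-(4 * Real.pi * n / N) * y) := by
    funext n; rw [rsCoeff_eq_sum, Finset.sum_mul]
  rw [e]
  exact summable_sum fun q _ ↦ (isCuspFunction_slash f _).summable_norm_sq_mul_exp hy

/-- **The horocycle average of the trace**: for `f ∈ S_k(Γ₀(N))` and `y > 0`,
`∫₀¹ G_f(x + iy) dx = yᵏ Σₙ C_f(n) e^{-4πny/N}` — `G_f` is `1`-periodic in `x`, so
`N ∫₀¹ = ∫₀ᴺ`, and over a full period `N` each translate `f |_k A⁻¹` is expanded by Parseval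
(Rankin 1939, §4, (4.2.3)). [cite: Rankin1939, §4] -/
theorem intervalIntegral_rsTrace_horizontal (f : CuspForm (Gamma0 N) k) {y : ℝ} (hy : 0 < y) :
    ∫ x in (0 : ℝ)..1, rsTrace N k f (ofComplex ((x : ℂ) + y * I)) =
      y ^ k * ∑' n : ℕ, rsCoeff N k f n * Real.exp (-(4 * Real.pi * n / N) * y) := by
  classical
  haveI : Fintype (SL(2, ℤ) ⧸ Gamma0 N) := Fintype.ofFinite _
  have hN0 : (0 : ℝ) < N := Nat.cast_pos.mpr (NeZero.pos N)
  -- `N ∫₀¹ = ∫₀ᴺ`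
  have hN := intervalIntegral_zero_nat_of_periodic (periodic_rsTrace_horizontal f hy)
    (continuous_rsTrace_horizontal f hy) N
  rw [smul_eq_mul] at hN
  -- expand `∫₀ᴺ` coset by coset
  have hsum : ∫ x in (0 : ℝ)..N, rsTrace N k f (ofComplex ((x : ℂ) + y * I)) =
      ∑ q : SL(2, ℤ) ⧸ Gamma0 N,
        ∫ x in (0 : ℝ)..N, petDensity k f ((Quotient.out q)⁻¹ • ofComplex ((x : ℂ) + y * I)) := by
    rw [← intervalIntegral.integral_finsetSum]
    · exact intervalIntegral.integral_congr fun x _ ↦ rsTrace_eq_sum _ _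
    · intro q _
      exact (continuous_petDensity_smul_horizontal f _ hy).intervalIntegrable _ _
  rw [hsum] at hN
  simp_rw [intervalIntegral_petDensity_smul_horizontal f _ hy] at hN
  rw [← Finset.mul_sum, ← Finset.mul_sum, ← Summable.tsum_finsetSum
    (fun q _ ↦ (isCuspFunction_slash f _).summable_norm_sq_mul_exp hy)] at hN
  have e : (fun n : ℕ ↦ ∑ q : SL(2, ℤ) ⧸ Gamma0 N,
      ‖(qExpansion (N : ℝ) ((⇑f) ∣[k] (Quotient.out q)⁻¹)).coeff n‖ ^ 2 *
        Real.exp (-(4 * Real.pi * n / N) * y)) =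
      fun n ↦ rsCoeff N k f n * Real.exp (-(4 * Real.pi * n / N) * y) := by
    funext n; rw [rsCoeff_eq_sum, Finset.sum_mul]
  rw [e] at hN
  -- cancel `N`
  have hN' : (N : ℝ) * ∫ x in (0 : ℝ)..1, rsTrace N k f (ofComplex ((x : ℂ) + y * I)) =
      (N : ℝ) * (y ^ k * ∑' n : ℕ, rsCoeff N k f n * Real.exp (-(4 * Real.pi * n / N) * y)) := by
    rw [← hN]; ring
  exact mul_left_cancel₀ hN0.ne' hN'

/-- **Bound for the generating series**: `Σₙ C_f(n) e^{-4πny/N} ≤ B y^{-k}` for `y > 0`, where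
`B` bounds `G_f` (`exists_rsTrace_le`). [folklore] -/
theorem tsum_rsCoeff_mul_exp_le (f : CuspForm (Gamma0 N) k) {B : ℝ} (hB : ∀ τ : ℍ, rsTrace N k f τ ≤ B)
    {y : ℝ} (hy : 0 < y) :
    ∑' n : ℕ, rsCoeff N k f n * Real.exp (-(4 * Real.pi * n / N) * y) ≤ B / y ^ k := by
  have hyk : 0 < y ^ k := zpow_pos hy k
  rw [le_div_iff₀ hyk, mul_comm, ← intervalIntegral_rsTrace_horizontal f hy]
  calc ∫ x in (0 : ℝ)..1, rsTrace N k f (ofComplex ((x : ℂ) + y * I))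
      ≤ ∫ _x in (0 : ℝ)..1, B :=
        intervalIntegral.integral_mono_on zero_le_one
          ((continuous_rsTrace_horizontal f hy).intervalIntegrable _ _)
          (continuous_const.intervalIntegrable _ _) (fun x _ ↦ hB _)
    _ = B := by simp

end Horocycle

end Literature.NumberTheory.EllipticCurves.ModularForms

end
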